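import Summits.BirchSwinnertonDyer.BirchSwinnertonDyer.Theorems.SylvesterTwoHeegnerIndexParametrizationRigidity
import Summits.BirchSwinnertonDyer.BirchSwinnertonDyer.Theorems.SylvesterTwoHeegnerIndexUpperConeOfPrintInputs
import HarnessLib

/-!
# Route `SylvesterTwoHeegnerIndex` (rung K7t): the admitted input (G3) from its PRINT-EXACT form (G3′), and the UPPER
# cone (crux `UpperOffV0HSYPlus` stmt-BirchSwinnertonDyer-19804, UPPER `HeegnerIndexUpperAtTwoHSYOfFactsPlus`
# stmt-…-19725, hand item `HeegnerIndexUpperAtTwoHSY` stmt-…-19229) BY NAME from `{(G3′), #19, #20, VII}`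

Cell `bsd-cm`, seat `bsd-cm-k7t-c2` g35 (hand «find: 19229»; planner D847 «(G3-MIN)»).  THEOREMS ONLY: composition of
`Theorems/SylvesterTwoHeegnerIndexParametrizationRigidity.lean` (rigidity: equal degree ⟹ `φ' = ±φ`) with g34's cone
`Theorems/SylvesterTwoHeegnerIndexUpperConeOfPrintInputs.lean` (p755365); no definition, no named fact, no instance, no
notation, no `sorry`.  `--supports stmt-BirchSwinnertonDyer-19804 --as helper`.

## What is proved

§1 **(G3) ⟸ (G3′).**  The admitted print binder (G3) `phi_s3Invariant_of_deg_eq_six` («EVERY degree-6 datum of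
`E₉ = ⟨0,0,1,0,−1⟩` at level `243` is `⟨w₂₄₃, A⟩`-invariant», Literature p749218, planner D816; its docstring flags the
«unprinted pinning») FOLLOWS from the print-exact statement (G3′) «SOME degree-6 datum is `⟨w₂₄₃, A⟩`-invariant» =
Hu–Shu–Yin Prop. 2.1 (1) (p. 5 L59–61, L76: `E₉ = X₀(3⁵)/S₃` [DV17]) + §4.1 (p. 10 L59: `f` is the quotient map
`X₀(3⁵) → X_Γ = E₉`; p. 11 L23: `deg f = 6`), because two degree-6 data are `±` each other and both fields of
`IsS3Invariant` read `φ (g • τ) = φ τ` (★★ `phi_s3Invariant_of_deg_eq_six_of_exists`; `…_iff_exists` granted one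
degree-6 datum).  The antecedent is DISPLAYED (no new `def`); the by-name corollary is one line once (G3′) is typed in
`Literature/…/HuShuYin2019/` (planner D847: k-ty1's Literature line).

§2 **The UPPER cone from the print-exact inputs.**  The registered PURE-CITE stub type of VARIANT S
(`stub_printInputsTwo` of `Cruxes/UpperOffV0HSYPlus/Lines/coupled_variantQ.lean` 135e3e428afeae9f =
`(∃ Dt, Dt.deg = 6) ∧ #19 ∧ #20 ∧ (G3)`) is DERIVED from `{(G3′), #19, #20}` (`printInputsTwo_of_exists_isS3Invariant`),
and the cone is re-threaded: crux 19804 (★★ `upperOffV0HSYPlus_of_exists_isS3Invariant`), UPPER 19725, the hand item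
19229 (★★★ `heegnerIndexUpperAtTwoHSY_of_publishedFactsTwoPlus_of_exists_isS3Invariant`) BY NAME, and the rung leaf
`X12.CMAtTwo` modulo the OPEN LOWER half, from `PublishedFactsTwoPlus` + PRINT `{(G3′), #19, #20, VII}` — the
`∀`-shaped admitted binder (G3) is no longer a hypothesis of the cone.

Honest label: faithfulness / bookkeeping of print inputs; CONDITIONAL theorems; nothing asserted on 19804; no ledger
item closed; `X12.CMAtTwo` NOT proved; BSD proved for no curve.

## References

* Y. Hu, J. Shu, H. Yin, *An explicit Gross–Zagier formula related to the Sylvester conjecture*, Trans. AMS 372 (2019)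
  = arXiv:1708.05266: Thm. 1.4, Prop. 2.1 (1) (p. 5), Cor. 4.4, display (bsd) p. 12, §4.1 (p. 10 L59, p. 11 L23). [HuShuYin2019]
* S. Dasgupta, J. Voight, *Sylvester's problem and mock Heegner points*, Proc. AMS 146 (2018), §2. [DasguptaVoight2018]
* J. Nekovář, *The Euler system method for CM points on Shimura curves* (2007), Prop. 4.9. [Nekovar2007]
* T. A. Fisher, *The Cassels–Tate pairing and the Platonic solids*, JNT 98 (2003), Prop. 2.16. [Fisher2003]
* J. S. Milne, *Arithmetic Duality Theorems*, 2nd ed. (2006), Ch. I §6. [MilneADT2006]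
* B. H. Gross, D. B. Zagier, *Heegner points and derivatives of L-series*, Invent. Math. 84 (1986). [GrossZagier1986]
-/

set_option linter.dupNamespace false -- Summits modules are `Summit.<Summit>.<Problem>…` by design
set_option autoImplicit false

noncomputable section

open scoped Classical MatrixGroups

open WeierstrassCurve UpperHalfPlane
open Literature.NumberTheory.EllipticCurves Literature.NumberTheory.EllipticCurves.ModularForms
  Literature.NumberTheory.EllipticCurves.HuShuYin2019
open Summit.BirchSwinnertonDyer.BirchSwinnertonDyer.Theorems
  Summit.BirchSwinnertonDyer.BirchSwinnertonDyer.Theorems.SylvesterTwoParamRigidity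

namespace Summit.BirchSwinnertonDyer.BirchSwinnertonDyer.Theorems.SylvesterTwoUpperConePrintExact


/-! ## §1 (G3) ⟸ (G3′): the admitted binder from the print-exact statement -/

section G3

variable {Dt Dt' : ModularParametrizationData (⟨0, 0, 1, 0, -1⟩ : WeierstrassCurve ℚ) 243}

/-- `⟨w₂₄₃, A⟩`-invariance transfers along `φ_{Dt'} = φ_{Dt}`. [cite: HuShuYin2019, Prop. 2.1 (1)] -/
theorem isS3Invariant_of_φ_eq (h : ∀ τ : ℍ, Dt'.φ τ = Dt.φ τ) (hS : IsS3Invariant Dt) : IsS3Invariant Dt' :=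
  ⟨fun τ ↦ by rw [h, h, hS.frickeGL_smul], fun τ ↦ by rw [h, h, hS.hsyA_smul]⟩

/-- `⟨w₂₄₃, A⟩`-invariance transfers along `φ_{Dt'} = −φ_{Dt}` (both fields of `IsS3Invariant` are equalities
`φ (g • τ) = φ τ`). [cite: HuShuYin2019, Prop. 2.1 (1)] -/
theorem isS3Invariant_of_φ_eq_neg (h : ∀ τ : ℍ, Dt'.φ τ = -Dt.φ τ) (hS : IsS3Invariant Dt) :
    IsS3Invariant Dt' :=
  ⟨fun τ ↦ by rw [h, h, hS.frickeGL_smul], fun τ ↦ by rw [h, h, hS.hsyA_smul]⟩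

/-- `⟨w₂₄₃, A⟩`-invariance transfers along an integer multiple: `c' = m c`. [cite: HuShuYin2019, Prop. 2.1 (1)] -/
theorem isS3Invariant_of_maninConstant_eq_mul {m : ℤ} (hc : Dt'.c = m * Dt.c) (hS : IsS3Invariant Dt) :
    IsS3Invariant Dt' :=
  ⟨fun τ ↦ by rw [φ_eq_zsmul_of_maninConstant_eq_mul Dt Dt' hc, φ_eq_zsmul_of_maninConstant_eq_mul Dt Dt' hc,
      hS.frickeGL_smul],
    fun τ ↦ by rw [φ_eq_zsmul_of_maninConstant_eq_mul Dt Dt' hc, φ_eq_zsmul_of_maninConstant_eq_mul Dt Dt' hc,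
      hS.hsyA_smul]⟩

/-- ★ **`⟨w₂₄₃, A⟩`-invariance is a property of the DEGREE**: two data of `E₉` at level `243` of the same degree are
`±` each other (`φ_eq_or_eq_neg_of_deg_eq`), so one is invariant iff the other is.
[cite: HuShuYin2019, Prop. 2.1 (1), §4.1] -/
theorem isS3Invariant_of_deg_eq (hdeg : Dt'.deg = Dt.deg) (hS : IsS3Invariant Dt) : IsS3Invariant Dt' := by
  rcases φ_eq_or_eq_neg_of_deg_eq Dt Dt' hdeg with h | h
  exacts [isS3Invariant_of_φ_eq h hS, isS3Invariant_of_φ_eq_neg h hS]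

/-- `⟨w₂₄₃, A⟩`-invariance at a fixed degree is all-or-none. [cite: HuShuYin2019, Prop. 2.1 (1), §4.1] -/
theorem isS3Invariant_iff_of_deg_eq (hdeg : Dt'.deg = Dt.deg) : IsS3Invariant Dt' ↔ IsS3Invariant Dt :=
  ⟨fun h ↦ isS3Invariant_of_deg_eq hdeg.symm h, fun h ↦ isS3Invariant_of_deg_eq hdeg h⟩

/-- ★★ **(G3) ⟸ (G3′).**  The admitted named fact `phi_s3Invariant_of_deg_eq_six` («EVERY degree-6 datum of `E₉` at
level `3⁵` is `⟨w₂₄₃, A⟩`-invariant», Literature p749218, flagged «unprinted pinning» in its docstring) FOLLOWS from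
the print-exact statement «SOME degree-6 datum is `⟨w₂₄₃, A⟩`-invariant» — Hu–Shu–Yin Prop. 2.1 (1) (p. 5 L59–61:
`(X_Γ, [∞]) ≅ E₉` over `ℚ`, `Γ = ⟨Γ₀(3⁵), W, A⟩`; proof L76: `E₉ = X₀(3⁵)/S₃` [DV17]) with §4.1 (p. 10 L59: «we may
take `f` to be the quotient map `X₀(3⁵) → X_Γ = E₉`»; p. 11 L23: «`deg f = 6`») — by rigidity
(`isS3Invariant_of_deg_eq`).  The antecedent is DISPLAYED verbatim (no new definition).
[cite: HuShuYin2019, Prop. 2.1 (1) (p. 5 L59–L61, L76), §4.1 (p. 10 L59, p. 11 L23)]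
[cite: DasguptaVoight2018, §2 (E₉ = X₀(243)/S₃)] -/
theorem phi_s3Invariant_of_deg_eq_six_of_exists
    (hG3' : ∃ Dt : ModularParametrizationData (⟨0, 0, 1, 0, -1⟩ : WeierstrassCurve ℚ) 243,
      Dt.deg = 6 ∧ IsS3Invariant Dt) :
    phi_s3Invariant_of_deg_eq_six := by
  obtain ⟨Dt₁, h₁, hS₁⟩ := hG3'
  intro Dt hdeg
  exact isS3Invariant_of_deg_eq (hdeg.trans h₁.symm) hS₁

/-- **(G3) ⟺ (G3′) granted ONE degree-6 datum** (the first conjunct of `stub_printInputsTwo`): the `∀`-shaped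
admitted binder and the `∃`-shaped print statement are interchangeable on the books.
[cite: HuShuYin2019, Prop. 2.1 (1), §4.1 (p. 10 L59, p. 11 L23)] -/
theorem phi_s3Invariant_of_deg_eq_six_iff_exists
    (hex : ∃ Dt : ModularParametrizationData (⟨0, 0, 1, 0, -1⟩ : WeierstrassCurve ℚ) 243, Dt.deg = 6) :
    phi_s3Invariant_of_deg_eq_six ↔
      ∃ Dt : ModularParametrizationData (⟨0, 0, 1, 0, -1⟩ : WeierstrassCurve ℚ) 243,
        Dt.deg = 6 ∧ IsS3Invariant Dt :=
  ⟨fun h ↦ h.exists_of_exists hex, phi_s3Invariant_of_deg_eq_six_of_exists⟩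

end G3

/-! ## §2 The UPPER cone of K7t from the print-exact inputs `{(G3′), #19, #20, VII}` -/

section Cone

/-- **The registered PURE-CITE stub type of VARIANT S** (`stub_printInputsTwo` of
`Cruxes/UpperOffV0HSYPlus/Lines/coupled_variantQ.lean` 135e3e428afeae9f: `(∃ Dt, Dt.deg = 6) ∧ #19 ∧ #20 ∧ (G3)`)
**DERIVED from the print-exact inputs** (G3′), #19, #20 — this is where rigidity enters the cone.
[cite: HuShuYin2019, Thm. 1.4, Cor. 4.4, display (bsd) p. 12, Prop. 2.1 (1), §4.1] [cite: Nekovar2007, Prop. 4.9] -/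
theorem printInputsTwo_of_exists_isS3Invariant
    (hG3' : ∃ Dt : ModularParametrizationData (⟨0, 0, 1, 0, -1⟩ : WeierstrassCurve ℚ) 243,
      Dt.deg = 6 ∧ IsS3Invariant Dt)
    (hD : shaAnPair_mul_height_eq_two_zpow_mul_height_named) (hES2 : Nekovar2007.cmPoint_frobeniusCongruence) :
    (∃ Dt : ModularParametrizationData (⟨0, 0, 1, 0, -1⟩ : WeierstrassCurve ℚ) 243, Dt.deg = 6) ∧
      shaAnPair_mul_height_eq_two_zpow_mul_height_named ∧ Nekovar2007.cmPoint_frobeniusCongruence ∧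
      phi_s3Invariant_of_deg_eq_six := by
  obtain ⟨Dt, hdeg, hS3⟩ := hG3'
  exact ⟨⟨Dt, hdeg⟩, hD, hES2, phi_s3Invariant_of_deg_eq_six_of_exists ⟨Dt, hdeg, hS3⟩⟩

/-- ★★ **The crux `UpperOffV0HSYPlus` (item 19804) BY NAME from `{(G3′), #19, #20, VII}`** (g34's
`upperOffV0HSYPlus_of_isS3Invariant` at the witness of (G3′); no rigidity needed here).  CONDITIONAL; 19804 is not
closed by this; BSD is proved for no curve.
[cite: HuShuYin2019, Thm. 1.4, Cor. 4.4, display (bsd) p. 12, Prop. 2.1 (1), §4.1] [cite: Nekovar2007, Prop. 4.9]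
[cite: Fisher2003, Prop. 2.16 (JNT 98, p. 132)] [cite: MilneADT2006, Ch. I §6 Rem. 6.10(a), Prop. 6.9, Thm. 6.13(a)] -/
theorem upperOffV0HSYPlus_of_exists_isS3Invariant
    (hG3' : ∃ Dt : ModularParametrizationData (⟨0, 0, 1, 0, -1⟩ : WeierstrassCurve ℚ) 243,
      Dt.deg = 6 ∧ IsS3Invariant Dt)
    (hD : shaAnPair_mul_height_eq_two_zpow_mul_height_named) (hES2 : Nekovar2007.cmPoint_frobeniusCongruence)
    (hVII : ∀ (K : Type) [Field K] [NumberField K] (σ₀ : K ≃ₐ[ℚ] K) (h2 : Module.finrank ℚ K = 2) (hσ₀ : σ₀ ≠ 1),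
      casselsTate_canonical_adjoint K σ₀ h2 hσ₀) :
    Summit.BirchSwinnertonDyer.BirchSwinnertonDyer.Theses.SylvesterTwoHeegnerIndex.UpperOffV0HSYPlus := by
  obtain ⟨Dt, hdeg, hS3⟩ := hG3'
  exact SylvesterTwoUpperCone.upperOffV0HSYPlus_of_isS3Invariant Dt hdeg hD hES2 hS3 hVII

/-- ★★ **The UPPER crux `HeegnerIndexUpperAtTwoHSYOfFactsPlus` (item 19725) BY NAME from `{(G3′), #19, #20, VII}`**
(g34's `…_of_printStubs` fed with `printInputsTwo_of_exists_isS3Invariant`).  CONDITIONAL; BSD is proved for no curve.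
[cite: HuShuYin2019, Thm. 1.4, Cor. 4.4, display (bsd) p. 12, Prop. 2.1 (1), §4.1] [cite: Nekovar2007, Prop. 4.9]
[cite: Fisher2003, Prop. 2.16 (JNT 98, p. 132)] [cite: MilneADT2006, Ch. I §6 Rem. 6.10(a), Prop. 6.9, Thm. 6.13(a)] -/
theorem heegnerIndexUpperAtTwoHSYOfFactsPlus_of_exists_isS3Invariant
    (hG3' : ∃ Dt : ModularParametrizationData (⟨0, 0, 1, 0, -1⟩ : WeierstrassCurve ℚ) 243,
      Dt.deg = 6 ∧ IsS3Invariant Dt)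
    (hD : shaAnPair_mul_height_eq_two_zpow_mul_height_named) (hES2 : Nekovar2007.cmPoint_frobeniusCongruence)
    (hVII : ∀ (K : Type) [Field K] [NumberField K] (σ₀ : K ≃ₐ[ℚ] K) (h2 : Module.finrank ℚ K = 2) (hσ₀ : σ₀ ≠ 1),
      casselsTate_canonical_adjoint K σ₀ h2 hσ₀) :
    Summit.BirchSwinnertonDyer.BirchSwinnertonDyer.Theses.SylvesterTwoHeegnerIndex.HeegnerIndexUpperAtTwoHSYOfFactsPlus :=
  SylvesterTwoUpperCone.heegnerIndexUpperAtTwoHSYOfFactsPlus_of_printStubs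
    (printInputsTwo_of_exists_isS3Invariant hG3' hD hES2) hVII

/-- ★★★ **The hand item `HeegnerIndexUpperAtTwoHSY` (stmt-BirchSwinnertonDyer-19229) BY NAME from
`PublishedFactsTwoPlus` + PRINT `{(G3′), #19, #20, VII}`** — the `∀`-shaped admitted binder (G3) is no longer a
hypothesis.  CONDITIONAL on the displayed print inputs; closes no ledger item; BSD is proved for no curve.
[cite: HuShuYin2019, Thm. 1.4, Cor. 4.4, display (bsd) p. 12, Prop. 2.1 (1), §4.1] [cite: Nekovar2007, Prop. 4.9]
[cite: Fisher2003, Prop. 2.16 (JNT 98, p. 132)] [cite: MilneADT2006, Ch. I §6 Rem. 6.10(a), Prop. 6.9, Thm. 6.13(a)]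
[cite: GrossZagier1986, V §2] [cite: Kolyvagin1990, Thm. A] -/
theorem heegnerIndexUpperAtTwoHSY_of_publishedFactsTwoPlus_of_exists_isS3Invariant
    (hF : Summit.BirchSwinnertonDyer.BirchSwinnertonDyer.Theses.SylvesterTwoHeegnerIndex.PublishedFactsTwoPlus)
    (hG3' : ∃ Dt : ModularParametrizationData (⟨0, 0, 1, 0, -1⟩ : WeierstrassCurve ℚ) 243,
      Dt.deg = 6 ∧ IsS3Invariant Dt)
    (hD : shaAnPair_mul_height_eq_two_zpow_mul_height_named) (hES2 : Nekovar2007.cmPoint_frobeniusCongruence)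
    (hVII : ∀ (K : Type) [Field K] [NumberField K] (σ₀ : K ≃ₐ[ℚ] K) (h2 : Module.finrank ℚ K = 2) (hσ₀ : σ₀ ≠ 1),
      casselsTate_canonical_adjoint K σ₀ h2 hσ₀) :
    Summit.BirchSwinnertonDyer.BirchSwinnertonDyer.Theses.SylvesterTwoHeegnerIndex.HeegnerIndexUpperAtTwoHSY :=
  SylvesterTwoUpperCone.heegnerIndexUpperAtTwoHSY_of_publishedFactsTwoPlus_of_printStubs hF
    (printInputsTwo_of_exists_isS3Invariant hG3' hD hES2) hVII

/-- ★★★ **The rung leaf `X12.CMAtTwo` ⟸ the OPEN LOWER half + `PublishedFactsTwoPlus` + PRINT `{(G3′), #19, #20, VII}`**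
(g34's bridge through the closed Assembly 19232).  What the K7t rung still needs, read off the binders: the LOWER crux
(items 19477 / 19891 / 19892 — research) and these prints.  CONDITIONAL; `X12.CMAtTwo` is NOT proved; BSD is proved
for no curve. [cite: HuShuYin2019, Thm. 1.4, Cor. 4.4, display (bsd) p. 12, Prop. 2.1 (1), §4.1]
[cite: Nekovar2007, Prop. 4.9] [cite: Fisher2003, Prop. 2.16 (JNT 98, p. 132)] [cite: GrossZagier1986, I (6.5), V §2] -/
theorem cmAtTwo_of_lower_of_publishedFactsTwoPlus_of_exists_isS3Invariant
    (hlo : Summit.BirchSwinnertonDyer.BirchSwinnertonDyer.Theses.SylvesterTwoHeegnerIndex.HeegnerIndexLowerAtTwoHSY)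
    (hF : Summit.BirchSwinnertonDyer.BirchSwinnertonDyer.Theses.SylvesterTwoHeegnerIndex.PublishedFactsTwoPlus)
    (hG3' : ∃ Dt : ModularParametrizationData (⟨0, 0, 1, 0, -1⟩ : WeierstrassCurve ℚ) 243,
      Dt.deg = 6 ∧ IsS3Invariant Dt)
    (hD : shaAnPair_mul_height_eq_two_zpow_mul_height_named) (hES2 : Nekovar2007.cmPoint_frobeniusCongruence)
    (hVII : ∀ (K : Type) [Field K] [NumberField K] (σ₀ : K ≃ₐ[ℚ] K) (h2 : Module.finrank ℚ K = 2) (hσ₀ : σ₀ ≠ 1),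
      casselsTate_canonical_adjoint K σ₀ h2 hσ₀) :
    Summit.BirchSwinnertonDyer.Rank1Residual.X12.CMAtTwo :=
  SylvesterTwoUpperCone.cmAtTwo_of_lower_of_publishedFactsTwoPlus_of_printStubs hlo hF
    (printInputsTwo_of_exists_isS3Invariant hG3' hD hES2) hVII

end Cone

end Summit.BirchSwinnertonDyer.BirchSwinnertonDyer.Theorems.SylvesterTwoUpperConePrintExact

end
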